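import Summits.Ventures.PercRepro.GenQSolidPlaneCount

/-!
# PercRepro — the row (R5a): the big solids pay demand-free sets themselves (night-4, gen 4)

For a solid `F` with `s ∈ {9, 10}` points of `G`, the `5`-subsets `A ⊆ F ∩ G` of rank `4` whose complement `G ∖ A`
spans are demand-free at type `5`.  If `G ∖ A` does NOT span, it lies in a flat `H` of rank `< q`; `P := F ∩ H` is a flat
of rank `≤ 3` (`F ⊄ H`) containing `(F ∩ G) ∖ A`, so `|P ∩ G| ≥ s − 5` and `A = ((F ∩ G) ∖ P) ∪ B` with `B ⊆ P ∩ F ∩ G`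
of `|P ∩ F ∩ G| − (s − 5)` points: the bad `A` inject into the pairs `(P, B)` over the planes `P` of `F`.  With the
triple budget `16 p₆ + 7 p₅ + 3 p₄ ≤ C(s, 3)` (`GenQSolidTriples`) the integer knapsack gives at least
`c₅(10) = 252 − 2·43 = 166` and `c₅(9) = 126 − 30 − 76 = 20` demand-free level-`5` sets per such solid.

* `c5`, `eRk_le_three_of_subset_solid_of_subset_flat`;
* `exists_plane_of_bad`: the plane `P = cl((F ∩ G) ∖ A)` and the shape of a bad `A`;
* `badFives`, `card_bad_fives_le`: `#bad ≤ Σ_{P : |P ∩ F ∩ G| ≥ s − 5} C(|P ∩ F ∩ G|, |P ∩ F ∩ G| + 5 − s)`.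

The assembly (`card_good_fives_ge`, the row `DFq_five_ge_big_solids`) is `GenQSolidGood`.  Imports `GenQSolidPlaneCount`.
-/
namespace PercRepro.Night4

open Finset ThmH SixFour GenQ PerFlat Star

variable {α : Type*} [DecidableEq α] {M : Matroid α} [M.Finite]

/-- `c₅(s)`: `166` at `s = 10`, `20` at `s = 9`, `0` otherwise. -/
def c5 (s : ℕ) : ℕ := if s = 10 then 166 else if s = 9 then 20 else 0

omit [DecidableEq α] in
/-- A subset `X ⊆ F` of a solid `F` lying in a flat `H` not containing `F` has rank `≤ 3`: rank `4` would give
`F = cl X ⊆ H`. -/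
theorem eRk_le_three_of_subset_solid_of_subset_flat {F X H : Finset α} (hF : F ∈ flatsQ M 4) (hXF : X ⊆ F)
    (hXH : X ⊆ H) (hH : M.IsFlat (H : Set α)) (hFH : ¬ F ⊆ H) : M.eRk (X : Set α) ≤ 3 := by
  have hF' := mem_flatsQ.1 hF
  obtain ⟨r, hr⟩ := exists_eRk_eq_nat (M := M) X
  have hr4 : r ≤ 4 := by
    have : M.eRk (X : Set α) ≤ ((4 : ℕ) : ℕ∞) := by
      rw [← hF'.2.2]
      exact M.eRk_mono (Finset.coe_subset.2 hXF)
    rw [hr] at this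
    exact_mod_cast this
  by_contra h
  have hr4' : r = 4 := by
    have : ¬ (r : ℕ∞) ≤ 3 := by rwa [hr] at h
    have : ¬ r ≤ 3 := fun hle => this (by exact_mod_cast hle)
    omega
  have hcl : M.closure (X : Set α) = M.closure (F : Set α) :=
    (M.isRkFinite_of_finite (Finset.finite_toSet X)).closure_eq_closure_of_subset_of_eRk_ge_eRk
      (Finset.coe_subset.2 hXF) (by rw [hF'.2.2, hr, hr4'])
  rw [hF'.2.1.closure] at hcl
  apply hFH
  intro x hx
  have hx' : x ∈ M.closure (X : Set α) := hcl ▸ Finset.mem_coe.2 hx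
  have : M.closure (X : Set α) ⊆ (H : Set α) := by
    rw [← hH.closure]
    exact M.closure_subset_closure (Finset.coe_subset.2 hXH)
  exact Finset.mem_coe.1 (this hx')

/-- **The shape of a bad set**: `A ⊆ F ∩ G` of rank `4` with `G ∖ A` not spanning determines a plane `P ∈ flatsQ M 3`,
`P ⊆ F`, with `(F ∩ G) ∖ A ⊆ P` (lines `≤ 3`; `s − 5 ≥ 4` points of `(F ∩ G) ∖ A`): `P = cl((F ∩ G) ∖ A)`. -/
theorem exists_plane_of_bad (hs : Simple M) (hline : ∀ L ∈ flatsQ M 2, L.card ≤ 3) {G F A : Finset α} {q : ℕ}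
    (hG : G ⊆ gr M) (hrG : M.eRk (G : Set α) = (q : ℕ∞)) (hF : F ∈ flatsQ M 4) (hA : A ⊆ F ∩ G)
    (hAc : A.card = 5) (h9 : 9 ≤ (F ∩ G).card) (hbad : G \ A ∉ Rq M G q) :
    ∃ P ∈ flatsQ M 3, P ⊆ F ∧ (F ∩ G) \ A ⊆ P := by
  have hF' := mem_flatsQ.1 hF
  have hGA : G \ A ⊆ G := Finset.sdiff_subset
  -- `H = cl(G ∖ A)` has rank `< q` and does not contain `F`
  have hrH : M.eRk ((G \ A : Finset α) : Set α) < (q : ℕ∞) := by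
    have hle : M.eRk ((G \ A : Finset α) : Set α) ≤ (q : ℕ∞) := by
      rw [← hrG]
      exact M.eRk_mono (Finset.coe_subset.2 hGA)
    exact lt_of_le_of_ne hle (fun h => hbad (mem_Rq.2 ⟨hGA, h⟩))
  set H := clF M (G \ A) with hHdef
  have hHflat : M.IsFlat (H : Set α) := by
    rw [hHdef, coe_clF]
    exact M.isFlat_closure _
  have hGAH : G \ A ⊆ H := by
    intro x hx
    rw [hHdef, ← Finset.mem_coe, coe_clF]
    have hxE : x ∈ M.E := by
      rw [← coe_gr M]
      exact Finset.mem_coe.2 (hG (Finset.mem_sdiff.1 hx).1)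
    exact M.mem_closure_of_mem' (Finset.mem_coe.2 hx) hxE
  have hFH : ¬ F ⊆ H := by
    intro hFH
    have hGH : G ⊆ H := by
      intro x hx
      by_cases hxA : x ∈ A
      · exact hFH (Finset.mem_inter.1 (hA hxA)).1
      · exact hGAH (Finset.mem_sdiff.2 ⟨hx, hxA⟩)
    have h1 : M.eRk (G : Set α) ≤ M.eRk (H : Set α) := M.eRk_mono (Finset.coe_subset.2 hGH)
    rw [hHdef, coe_clF, M.eRk_closure_eq, hrG] at h1
    exact absurd (lt_of_le_of_lt h1 hrH) (lt_irrefl _)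
  set X := (F ∩ G) \ A with hXdef
  have hXF : X ⊆ F := Finset.sdiff_subset.trans Finset.inter_subset_left
  have hXH : X ⊆ H := by
    intro x hx
    rw [hXdef, Finset.mem_sdiff, Finset.mem_inter] at hx
    exact hGAH (Finset.mem_sdiff.2 ⟨hx.1.2, hx.2⟩)
  have hXr := eRk_le_three_of_subset_solid_of_subset_flat hF hXF hXH hHflat hFH
  have hXg : X ⊆ gr M := hXF.trans hF'.1
  have hXE : (X : Set α) ⊆ M.E := by
    rw [← coe_gr M]
    exact Finset.coe_subset.2 hXg
  have hX4 : 4 ≤ X.card := by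
    have : ((F ∩ G) \ A).card = (F ∩ G).card - A.card := Finset.card_sdiff_of_subset hA
    rw [hXdef, this]
    omega
  have hXr3 : M.eRk (X : Set α) = ((3 : ℕ) : ℕ∞) := by
    apply le_antisymm hXr
    by_contra h
    have hle : M.eRk (X : Set α) ≤ 2 := by
      obtain ⟨r, hr⟩ := exists_eRk_eq_nat (M := M) X
      rw [hr] at h ⊢
      have : ¬ 3 ≤ r := fun hle => h (by exact_mod_cast hle)
      exact_mod_cast (show r ≤ 2 by omega)
    have := card_le_three_of_eRk_le_two' hs hline hXg hle
    omega
  refine ⟨clF M X, mem_flatsQ.2 ⟨?_, ?_, ?_⟩, ?_, ?_⟩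
  · intro x hx
    rw [← Finset.mem_coe, coe_clF] at hx
    have := M.closure_subset_ground _ hx
    rw [← coe_gr M] at this
    exact Finset.mem_coe.1 this
  · rw [coe_clF]
    exact M.isFlat_closure _
  · rw [coe_clF, M.eRk_closure_eq, hXr3]
  · intro x hx
    rw [← Finset.mem_coe, coe_clF] at hx
    have hsub : M.closure (X : Set α) ⊆ (F : Set α) := by
      rw [← hF'.2.1.closure]
      exact M.closure_subset_closure (Finset.coe_subset.2 hXF)
    exact Finset.mem_coe.1 (hsub hx)
  · intro x hx
    rw [← Finset.mem_coe, coe_clF]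
    have hxE : x ∈ M.E := hXE (Finset.mem_coe.2 hx)
    exact M.mem_closure_of_mem' (Finset.mem_coe.2 hx) hxE

/-! ## Counting the bad sets -/

/-- The bad `5`-subsets of `F ∩ G` (rank `4`, non-spanning complement). -/
noncomputable def badFives (M : Matroid α) [M.Finite] (G F : Finset α) (q : ℕ) : Finset (Finset α) :=
  ((F ∩ G).powersetCard 5).filter
    (fun A : Finset α => M.eRk (A : Set α) = ((4 : ℕ) : ℕ∞) ∧ G \ A ∉ Rq M G q)

/-- **The bad sets inject into the pairs `(P, B)`**, `P` a plane, `B ⊆ P ∩ F ∩ G` with `|P ∩ F ∩ G| + 5 − s` points: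
`#bad ≤ Σ_{P ∈ flatsQ M 3} C(|P ∩ (F ∩ G)|, |P ∩ (F ∩ G)| + 5 − s)`. -/
theorem card_bad_fives_le (hs : Simple M) (hline : ∀ L ∈ flatsQ M 2, L.card ≤ 3) {G F : Finset α} {q : ℕ}
    (hG : G ⊆ gr M) (hrG : M.eRk (G : Set α) = (q : ℕ∞)) (hF : F ∈ flatsQ M 4) (h9 : 9 ≤ (F ∩ G).card) :
    (badFives M G F q).card ≤
      ∑ P ∈ (flatsQ M 3).filter (fun P : Finset α => (F ∩ G).card - 5 ≤ (P ∩ (F ∩ G)).card),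
        (P ∩ (F ∩ G)).card.choose ((P ∩ (F ∩ G)).card + 5 - (F ∩ G).card) := by
  set X := F ∩ G with hXdef
  set s := X.card with hsdef
  -- the target: pairs `(P, B)` as a sigma finset
  have htarget : ∑ P ∈ (flatsQ M 3).filter (fun P : Finset α => s - 5 ≤ (P ∩ X).card),
      (P ∩ X).card.choose ((P ∩ X).card + 5 - s) =
      (((flatsQ M 3).filter (fun P : Finset α => s - 5 ≤ (P ∩ X).card)).sigma
        (fun P : Finset α => (P ∩ X).powersetCard ((P ∩ X).card + 5 - s))).card := by
    rw [Finset.card_sigma]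
    apply Finset.sum_congr rfl
    intro P _
    rw [Finset.card_powersetCard]
  rw [htarget]
  apply Finset.card_le_card_of_injOn (fun A => ⟨clF M (X \ A), A ∩ clF M (X \ A)⟩)
  · intro A hA
    rw [Finset.mem_coe] at hA
    unfold badFives at hA
    rw [Finset.mem_filter, Finset.mem_powersetCard] at hA
    obtain ⟨⟨hAX, hAc⟩, hAr, hbad⟩ := hA
    obtain ⟨P, hP, hPF, hsub⟩ := exists_plane_of_bad hs hline hG hrG hF hAX hAc h9 hbad
    -- `P = cl(X ∖ A)` by construction of `exists_plane_of_bad`; we only need `cl(X ∖ A) ∈ flatsQ M 3`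
    -- which the proof provides as that very flat: re-derive it directly
    have hXA4 : 4 ≤ (X \ A).card := by
      have : (X \ A).card = X.card - A.card := Finset.card_sdiff_of_subset hAX
      omega
    have hPcl : clF M (X \ A) ∈ flatsQ M 3 := by
      -- `X ∖ A ⊆ P` of rank `3` and `|X ∖ A| ≥ 4` give `cl(X ∖ A) = P`
      have hP' := mem_flatsQ.1 hP
      have hXAg : X \ A ⊆ gr M := Finset.sdiff_subset.trans (Finset.inter_subset_right.trans hG)
      have hr : M.eRk ((X \ A : Finset α) : Set α) = ((3 : ℕ) : ℕ∞) := by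
        apply le_antisymm
        · rw [← hP'.2.2]
          exact M.eRk_mono (Finset.coe_subset.2 hsub)
        · by_contra h
          have hle : M.eRk ((X \ A : Finset α) : Set α) ≤ 2 := by
            obtain ⟨r, hr⟩ := exists_eRk_eq_nat (M := M) (X \ A)
            rw [hr] at h ⊢
            have : ¬ 3 ≤ r := fun hle => h (by exact_mod_cast hle)
            exact_mod_cast (show r ≤ 2 by omega)
          have := card_le_three_of_eRk_le_two' hs hline hXAg hle
          omega
      refine mem_flatsQ.2 ⟨?_, ?_, ?_⟩
      · intro x hx
        rw [← Finset.mem_coe, coe_clF] at hx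
        have := M.closure_subset_ground _ hx
        rw [← coe_gr M] at this
        exact Finset.mem_coe.1 this
      · rw [coe_clF]
        exact M.isFlat_closure _
      · rw [coe_clF, M.eRk_closure_eq, hr]
    rw [Finset.mem_coe, Finset.mem_sigma]
    set P := clF M (X \ A) with hPdef
    have hXAP : X \ A ⊆ P := by
      intro x hx
      rw [hPdef, ← Finset.mem_coe, coe_clF]
      have hxE : x ∈ M.E := by
        rw [← coe_gr M]
        exact Finset.mem_coe.2 (Finset.inter_subset_right.trans hG (Finset.mem_sdiff.1 hx).1)
      exact M.mem_closure_of_mem' (Finset.mem_coe.2 hx) hxE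
    have hsub1 : A ∩ P ⊆ P ∩ X := by
      intro x hx
      rw [Finset.mem_inter] at hx ⊢
      exact ⟨hx.2, hAX hx.1⟩
    have hPX : s - 5 ≤ (P ∩ X).card := by
      have h1 : (X \ A).card = X.card - A.card := Finset.card_sdiff_of_subset hAX
      have h2 : X \ A ⊆ P ∩ X := fun x hx => Finset.mem_inter.2 ⟨hXAP hx, (Finset.mem_sdiff.1 hx).1⟩
      have := Finset.card_le_card h2
      omega
    refine ⟨Finset.mem_filter.2 ⟨hPcl, hPX⟩, ?_⟩
    rw [Finset.mem_powersetCard]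
    refine ⟨hsub1, ?_⟩
    show (A ∩ P).card = (P ∩ X).card + 5 - s
    -- `A ∖ P = X ∖ P`, so `|A ∩ P| = 5 − |X ∖ P| = |P ∩ X| + 5 − s`
    have hAP : A \ P = X \ P := by
      ext x
      rw [Finset.mem_sdiff, Finset.mem_sdiff]
      constructor
      · rintro ⟨hxA, hxP⟩
        exact ⟨hAX hxA, hxP⟩
      · rintro ⟨hxX, hxP⟩
        refine ⟨?_, hxP⟩
        by_contra hxA
        exact hxP (hXAP (Finset.mem_sdiff.2 ⟨hxX, hxA⟩))
    have h1 : (A ∩ P).card + (A \ P).card = A.card := Finset.card_inter_add_card_sdiff A P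
    have h2 : (X \ P).card + (X ∩ P).card = X.card := Finset.card_sdiff_add_card_inter X P
    have h3 : (X ∩ P).card = (P ∩ X).card := by rw [Finset.inter_comm]
    have h4 : (X \ P).card ≤ 5 := by
      rw [← hAP]
      exact (Finset.card_le_card Finset.sdiff_subset).trans (le_of_eq hAc)
    rw [hAP] at h1
    omega
  · intro A hA A' hA' heq
    rw [Finset.mem_coe] at hA hA'
    unfold badFives at hA hA'
    rw [Finset.mem_filter, Finset.mem_powersetCard] at hA hA'
    simp only [Sigma.mk.injEq] at heq
    obtain ⟨hPeq, hBeq⟩ := heq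
    have hBeq' : A ∩ clF M (X \ A) = A' ∩ clF M (X \ A') := eq_of_heq hBeq
    -- `A = (X ∖ P) ∪ (A ∩ P)` for `P = cl(X ∖ A)`, and the same for `A'` with the same `P`
    have key : ∀ (A₀ : Finset α), A₀ ⊆ X → A₀ = (X \ clF M (X \ A₀)) ∪ (A₀ ∩ clF M (X \ A₀)) := by
      intro A₀ hA₀X
      have hXAP : X \ A₀ ⊆ clF M (X \ A₀) := by
        intro x hx
        rw [← Finset.mem_coe, coe_clF]
        have hxE : x ∈ M.E := by
          rw [← coe_gr M]
          exact Finset.mem_coe.2 (Finset.inter_subset_right.trans hG (Finset.mem_sdiff.1 hx).1)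
        exact M.mem_closure_of_mem' (Finset.mem_coe.2 hx) hxE
      ext x
      constructor
      · intro hx
        by_cases hxP : x ∈ clF M (X \ A₀)
        · exact Finset.mem_union_right _ (Finset.mem_inter.2 ⟨hx, hxP⟩)
        · exact Finset.mem_union_left _ (Finset.mem_sdiff.2 ⟨hA₀X hx, hxP⟩)
      · intro hx
        rcases Finset.mem_union.1 hx with h | h
        · have h' := Finset.mem_sdiff.1 h
          by_contra hxA
          exact h'.2 (hXAP (Finset.mem_sdiff.2 ⟨h'.1, hxA⟩))
        · exact (Finset.mem_inter.1 h).1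
    rw [key A hA.1.1, key A' hA'.1.1, hBeq', hPeq]

end PercRepro.Night4
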